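import Summits.CriticalPhenomena.PercolationContinuityZ3.Theorems.PercGamblersRuinVerticalGamblersRuinStubStationarity

/-!
# Route `PercGamblersRuin`, crux `VerticalGamblersRuin` (stmt-CriticalPhenomena-10642):
# stub `stub_kirchhoffOfWeak` — a weakly Kirchhoff flow satisfies the node law pointwise

Helper file for the stub `stub_kirchhoffOfWeak` of the line `registered` (skeleton rev 10,
Theorem B1(a–b)) of the crux `PercGamblersRuin.VerticalGamblersRuin`.

Setting.  Bond configurations `ω` on `ℤ³` under `P = P_{p_c}`; `C = {0 ↔ ∞}`;
`O_y = {ω | s(0, y) ∈ ω}`; `N_ω(0)` is the set of lattice neighbours `y ∼ 0` with `s(0, y)` open;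
`ω - x = BondConfig.relabel (sym2Equiv (Site.shift (-x))) ω` is the configuration seen from `x`
(entering the statement as `sh`, pinned by `hsh`).  A family `θ_y : Ω → ℝ` (`y ∼ 0`) of weights
on the directed open edges `0 → y`, measurable and integrable on `C ∩ O_y`, is *weakly Kirchhoff*
if `∑_{y ∼ 0} ∫_{C ∩ O_y} θ_y(ω) (ψ(ω - y) - ψ(ω)) dP = 0` for every bounded measurable `ψ`
(orthogonality to all coboundaries).

Statement proved (exact registered signature): a weakly Kirchhoff family satisfies, almost
surely, at EVERY vertex `x` of the infinite cluster (`ω - x ∈ C`), Kirchhoff's node law for the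
antisymmetrised field: `∑_{y ∈ N_{ω-x}(0)} (θ_y(ω - x) - θ_{-y}((ω - x) - y)) = 0`.

Proof.  (a) SUBSTITUTION `ω = ω' + y`: the shift `ω ↦ ω - y` preserves `P`
(`bondPercolation_map_shift`) and pulls `C ∩ O_{-y}` back to `C ∩ O_y` (an open edge joins the
clusters of its endpoints, `StubClusterComparison.mem_percolatesAt_iff_of_mem_filter`), so
`∫_{C ∩ O_y} g(ω - y) dP = ∫_{C ∩ O_{-y}} g dP` and integrability is transported likewise.
(b) Hence, reindexing `y ↦ -y`, `∑_y ∫_{C∩O_y} θ_y ψ(· - y) = ∑_y ∫_{C∩O_y} θ_{-y}(· - y) ψ`, and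
weak Kirchhoff becomes `∫_C D · ψ dP = 0` for all bounded measurable `ψ`, where the flux defect
`D(ω) = ∑_{y ∈ N_ω(0)} (θ_y(ω) - θ_{-y}(ω - y))` (entering as `D`, pinned by `hD`) is integrable
on `C`.  (c) The clamp `ψ = max(-1, min(1, D))` gives `D ψ ≥ 0` with `∫_C D ψ = 0`, so `D = 0`
a.e. on `C`: the claim at `x = 0`.  (d) The claim at `x` is the same null event pulled back by
the measure-preserving map `ω ↦ ω - x` (`(ω - x) - y` is literally `sh y (sh x ω)`); countable
intersection over `x ∈ ℤ³`.

## References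

* R. Lyons, Y. Peres, *Probability on Trees and Networks*, Cambridge University Press (2016),
  §2.1, §9.1 (flows, Kirchhoff's node law, coboundaries / stars and their orthogonal complement).
* A. De Masi, P. A. Ferrari, S. Goldstein, W. D. Wick, *An invariance principle for reversible
  Markov processes. Applications to random motions in random environments*, J. Statist. Phys.
  55 (1989), 787–855, §4 (the environment seen from the walker on the percolation cluster).
* G. Grimmett, *Percolation*, 2nd ed., Springer (1999), §1.6 (translation invariance of `P_p`).
-/

noncomputable section

namespace Summit.CriticalPhenomena.PercolationContinuityZ3.Theorems.VerticalGamblersRuin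

open MeasureTheory Filter Topology
open Literature.Probability.Percolation Literature.Probability.LatticeModels
open scoped Classical

namespace StubKirchhoffOfWeak

/-! ### Shifts: measure preservation and the pull-back of `C ∩ O_{-y}` -/

/-- The shift `ω ↦ ω + v` of configurations preserves `P_{p_c}` (translation invariance). -/
theorem measurePreserving_shift (v : Site 3) :
    MeasurePreserving (BondConfig.relabel (sym2Equiv (Site.shift v)))
      (bondPercolation (zdGraph 3) (criticalProbI 3))
      (bondPercolation (zdGraph 3) (criticalProbI 3)) :=
  ⟨(BondConfig.relabel (sym2Equiv (Site.shift v))).measurable, bondPercolation_map_shift v _⟩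

/-- `(ω - y) + y = ω`, written with `+ y = - (-y)`. -/
theorem relabel_shift_neg_neg_relabel_shift_neg (y : Site 3) (ω : BondConfig (Site 3)) :
    BondConfig.relabel (sym2Equiv (Site.shift (-(-y))))
        (BondConfig.relabel (sym2Equiv (Site.shift (-y))) ω) = ω := by
  rw [StubStationarity.relabel_shift_neg_relabel_shift_neg, neg_add_cancel,
    StubStationarity.relabel_shift_neg_zero]

/-- `-y ∼ 0` whenever `y ∼ 0`. -/
theorem neg_mem_neighborFinset {y : Site 3} (hy : y ∈ (zdGraph 3).neighborFinset (0 : Site 3)) :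
    -y ∈ (zdGraph 3).neighborFinset (0 : Site 3) := by
  rw [SimpleGraph.mem_neighborFinset] at hy ⊢
  exact ((StubStationarity.zdGraph_adj_neg_zero_iff y).2 hy).symm

/-- Reindexing a sum over the lattice neighbours of `0` through `y ↦ -y`. -/
theorem sum_neighborFinset_neg (F : Site 3 → ℝ) :
    ∑ y ∈ (zdGraph 3).neighborFinset (0 : Site 3), F (-y) =
      ∑ y ∈ (zdGraph 3).neighborFinset (0 : Site 3), F y := by
  refine Finset.sum_equiv (Equiv.neg (Site 3)) (fun y => ?_) (fun y _ => rfl)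
  rw [SimpleGraph.mem_neighborFinset, SimpleGraph.mem_neighborFinset, Equiv.neg_apply,
    ← StubStationarity.zdGraph_adj_neg_zero_iff y]
  exact (zdGraph 3).adj_comm _ _

/-- For a lattice neighbour `y` of `0`, the shift `ω ↦ ω - y` pulls `C ∩ O_{-y}` back to
`C ∩ O_y`: `s(0, -y) ∈ ω - y ↔ s(y, 0) ∈ ω`, and `ω - y ∈ {0 ↔ ∞} ↔ ω ∈ {y ↔ ∞} ↔ ω ∈ {0 ↔ ∞}`
on `{s(0, y) ∈ ω}` (an open edge joins the clusters of its endpoints). -/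
theorem preimage_inter_eq {y : Site 3} (hy : (zdGraph 3).Adj (0 : Site 3) y) :
    BondConfig.relabel (sym2Equiv (Site.shift (-y))) ⁻¹'
        (percolatesAt (0 : Site 3) ∩ {ω | s((0 : Site 3), -y) ∈ ω}) =
      percolatesAt (0 : Site 3) ∩ {ω | s((0 : Site 3), y) ∈ ω} := by
  ext ω
  have he : s((0 : Site 3), -y) ∈ BondConfig.relabel (sym2Equiv (Site.shift (-y))) ω ↔
      s((0 : Site 3), y) ∈ ω := by
    rw [StubStationarity.mk_mem_relabel_shift_neg_iff, zero_add, neg_add_cancel, Sym2.eq_swap]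
  have hC : BondConfig.relabel (sym2Equiv (Site.shift (-y))) ω ∈ percolatesAt (0 : Site 3) ↔
      ω ∈ percolatesAt y := by
    have h := relabel_mem_percolatesAt_iff (Site.shift (-y)) ω y
    rwa [Site.shift_apply, add_neg_cancel] at h
  simp only [Set.mem_preimage, Set.mem_inter_iff, Set.mem_setOf_eq, he, hC]
  constructor
  · rintro ⟨hp, ho⟩
    exact ⟨(StubClusterComparison.mem_percolatesAt_iff_of_mem_filter (Finset.mem_filter.2
      ⟨(SimpleGraph.mem_neighborFinset _ _ _).2 hy, ho⟩)).2 hp, ho⟩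
  · rintro ⟨hp, ho⟩
    exact ⟨(StubClusterComparison.mem_percolatesAt_iff_of_mem_filter (Finset.mem_filter.2
      ⟨(SimpleGraph.mem_neighborFinset _ _ _).2 hy, ho⟩)).1 hp, ho⟩

/-- **Transport of integrability** by the substitution `ω = ω' + y` (`y ∼ 0`):
`g(· - y)` is integrable on `C ∩ O_y` iff `g` is integrable on `C ∩ O_{-y}`. -/
theorem integrableOn_comp_iff {y : Site 3} (hy : (zdGraph 3).Adj (0 : Site 3) y)
    (g : BondConfig (Site 3) → ℝ) :
    IntegrableOn (fun ω => g (BondConfig.relabel (sym2Equiv (Site.shift (-y))) ω))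
        (percolatesAt (0 : Site 3) ∩ {ω | s((0 : Site 3), y) ∈ ω})
        (bondPercolation (zdGraph 3) (criticalProbI 3)) ↔
      IntegrableOn g (percolatesAt (0 : Site 3) ∩ {ω | s((0 : Site 3), -y) ∈ ω})
        (bondPercolation (zdGraph 3) (criticalProbI 3)) := by
  rw [← preimage_inter_eq hy]
  exact (measurePreserving_shift (-y)).integrableOn_comp_preimage
    (BondConfig.relabel (sym2Equiv (Site.shift (-y)))).measurableEmbedding

/-- **The substitution `ω = ω' + y`** (`y ∼ 0`):
`∫_{C ∩ O_y} g(ω - y) dP(ω) = ∫_{C ∩ O_{-y}} g(ω') dP(ω')` (no hypotheses on `g`). -/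
theorem setIntegral_comp_eq {y : Site 3} (hy : (zdGraph 3).Adj (0 : Site 3) y)
    (g : BondConfig (Site 3) → ℝ) :
    ∫ ω in percolatesAt (0 : Site 3) ∩ {ω | s((0 : Site 3), y) ∈ ω},
        g (BondConfig.relabel (sym2Equiv (Site.shift (-y))) ω)
        ∂(bondPercolation (zdGraph 3) (criticalProbI 3)) =
      ∫ ω in percolatesAt (0 : Site 3) ∩ {ω | s((0 : Site 3), -y) ∈ ω}, g ω
        ∂(bondPercolation (zdGraph 3) (criticalProbI 3)) := by
  rw [← preimage_inter_eq hy]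
  exact (measurePreserving_shift (-y)).setIntegral_preimage_emb
    (BondConfig.relabel (sym2Equiv (Site.shift (-y)))).measurableEmbedding g _

/-! ### The antisymmetrised flux defect `D` at the origin (pinned by its formula `hD`) -/

/-- The flux defect `D(ω) = ∑_{y ∼ 0} 1_{s(0,y) ∈ ω} (θ_y(ω) - θ_{-y}(ω - y))` is measurable
(measurable weights, one-edge events, measurable shifts). -/
theorem measurable_defect {θ : Site 3 → BondConfig (Site 3) → ℝ} (hθm : ∀ y, Measurable (θ y))
    {D : BondConfig (Site 3) → ℝ}
    (hD : ∀ ω, D ω = ∑ y ∈ (zdGraph 3).neighborFinset (0 : Site 3),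
      if s((0 : Site 3), y) ∈ ω then
        θ y ω - θ (-y) (BondConfig.relabel (sym2Equiv (Site.shift (-y))) ω) else 0) :
    Measurable D := by
  show Measurable fun ω => D ω
  simp_rw [hD]
  refine Finset.measurable_sum _ fun y _ => ?_
  exact Measurable.ite (measurableSet_mem (s((0 : Site 3), y) : Sym2 (Site 3)))
    ((hθm y).sub ((hθm (-y)).comp
      (BondConfig.relabel (sym2Equiv (Site.shift (-y)))).measurable)) measurable_const

/-- The flux defect is integrable on `C`: `θ_y` is integrable on `C ∩ O_y` by hypothesis and
`θ_{-y}(· - y)` by transport of the hypothesis for `-y` (`integrableOn_comp_iff`). -/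
theorem integrableOn_defect {θ : Site 3 → BondConfig (Site 3) → ℝ}
    (hθi : ∀ y ∈ (zdGraph 3).neighborFinset (0 : Site 3),
      IntegrableOn (θ y) (percolatesAt (0 : Site 3) ∩ {ω | s((0 : Site 3), y) ∈ ω})
        (bondPercolation (zdGraph 3) (criticalProbI 3)))
    {D : BondConfig (Site 3) → ℝ}
    (hD : ∀ ω, D ω = ∑ y ∈ (zdGraph 3).neighborFinset (0 : Site 3),
      if s((0 : Site 3), y) ∈ ω then
        θ y ω - θ (-y) (BondConfig.relabel (sym2Equiv (Site.shift (-y))) ω) else 0) :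
    IntegrableOn D (percolatesAt (0 : Site 3)) (bondPercolation (zdGraph 3) (criticalProbI 3)) := by
  have hO : ∀ y : Site 3, MeasurableSet {ω : BondConfig (Site 3) | s((0 : Site 3), y) ∈ ω} :=
    fun y => measurableSet_mem _
  have h : D = fun ω => ∑ y ∈ (zdGraph 3).neighborFinset (0 : Site 3),
      {ω : BondConfig (Site 3) | s((0 : Site 3), y) ∈ ω}.indicator
        (fun ω => θ y ω - θ (-y) (BondConfig.relabel (sym2Equiv (Site.shift (-y))) ω)) ω := by
    funext ω
    rw [hD]
    refine Finset.sum_congr rfl fun y _ => ?_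
    simp only [Set.indicator_apply, Set.mem_setOf_eq]
  rw [IntegrableOn, h]
  refine integrable_finsetSum _ fun y hy => ?_
  refine IntegrableOn.integrable_indicator ?_ (hO y)
  rw [IntegrableOn, Measure.restrict_restrict (hO y), Set.inter_comm]
  have hy' : (zdGraph 3).Adj (0 : Site 3) y := (SimpleGraph.mem_neighborFinset _ _ _).1 hy
  exact (hθi y hy).sub' ((integrableOn_comp_iff hy' (θ (-y))).2
    (hθi (-y) (neg_mem_neighborFinset hy)))

/-- **Weak Kirchhoff, recentred.**  For every bounded measurable `ψ`,
`∫_C D(ω) ψ(ω) dP = 0`: split the weak Kirchhoff identity, move `ψ(ω - y)` back to `ψ(ω')`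
by the substitution `ω = ω' + y` (`setIntegral_comp_eq`) and reindex `y ↦ -y`. -/
theorem setIntegral_defect_mul {θ : Site 3 → BondConfig (Site 3) → ℝ}
    (hθi : ∀ y ∈ (zdGraph 3).neighborFinset (0 : Site 3),
      IntegrableOn (θ y) (percolatesAt (0 : Site 3) ∩ {ω | s((0 : Site 3), y) ∈ ω})
        (bondPercolation (zdGraph 3) (criticalProbI 3)))
    {D : BondConfig (Site 3) → ℝ}
    (hD : ∀ ω, D ω = ∑ y ∈ (zdGraph 3).neighborFinset (0 : Site 3),
      if s((0 : Site 3), y) ∈ ω then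
        θ y ω - θ (-y) (BondConfig.relabel (sym2Equiv (Site.shift (-y))) ω) else 0)
    (hweak : ∀ (ψ : BondConfig (Site 3) → ℝ) (B : ℝ), Measurable ψ → (∀ ω, |ψ ω| ≤ B) →
      ∑ y ∈ (zdGraph 3).neighborFinset (0 : Site 3),
        ∫ ω in percolatesAt (0 : Site 3) ∩ {ω | s((0 : Site 3), y) ∈ ω},
          θ y ω * (ψ (BondConfig.relabel (sym2Equiv (Site.shift (-y))) ω) - ψ ω)
          ∂(bondPercolation (zdGraph 3) (criticalProbI 3)) = 0)
    {ψ : BondConfig (Site 3) → ℝ} {B : ℝ} (hψm : Measurable ψ) (hψb : ∀ ω, |ψ ω| ≤ B) :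
    ∫ ω in percolatesAt (0 : Site 3), D ω * ψ ω ∂(bondPercolation (zdGraph 3) (criticalProbI 3)) =
      0 := by
  have hO : ∀ y : Site 3, MeasurableSet {ω : BondConfig (Site 3) | s((0 : Site 3), y) ∈ ω} :=
    fun y => measurableSet_mem _
  -- integrability of the three kinds of terms on `C ∩ O_y`
  have hI1 : ∀ y ∈ (zdGraph 3).neighborFinset (0 : Site 3),
      IntegrableOn (fun ω => θ y ω * ψ (BondConfig.relabel (sym2Equiv (Site.shift (-y))) ω))
        (percolatesAt (0 : Site 3) ∩ {ω | s((0 : Site 3), y) ∈ ω})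
        (bondPercolation (zdGraph 3) (criticalProbI 3)) := fun y hy =>
    (hθi y hy).mul_bdd ((hψm.comp
      (BondConfig.relabel (sym2Equiv (Site.shift (-y)))).measurable).aestronglyMeasurable)
      (ae_of_all _ fun ω => (Real.norm_eq_abs _).trans_le (hψb _))
  have hI2 : ∀ y ∈ (zdGraph 3).neighborFinset (0 : Site 3),
      IntegrableOn (fun ω => θ y ω * ψ ω) (percolatesAt (0 : Site 3) ∩ {ω | s((0 : Site 3), y) ∈ ω})
        (bondPercolation (zdGraph 3) (criticalProbI 3)) := fun y hy =>
    (hθi y hy).mul_bdd hψm.aestronglyMeasurable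
      (ae_of_all _ fun ω => (Real.norm_eq_abs _).trans_le (hψb _))
  have hI3 : ∀ y ∈ (zdGraph 3).neighborFinset (0 : Site 3),
      IntegrableOn (fun ω => θ (-y) (BondConfig.relabel (sym2Equiv (Site.shift (-y))) ω) * ψ ω)
        (percolatesAt (0 : Site 3) ∩ {ω | s((0 : Site 3), y) ∈ ω})
        (bondPercolation (zdGraph 3) (criticalProbI 3)) := by
    intro y hy
    have hy' : (zdGraph 3).Adj (0 : Site 3) y := (SimpleGraph.mem_neighborFinset _ _ _).1 hy
    have h := (integrableOn_comp_iff hy' (fun ω => θ (-y) ω *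
      ψ (BondConfig.relabel (sym2Equiv (Site.shift (-(-y)))) ω))).2
      ((hθi (-y) (neg_mem_neighborFinset hy)).mul_bdd ((hψm.comp
        (BondConfig.relabel (sym2Equiv (Site.shift (-(-y))))).measurable).aestronglyMeasurable)
        (ae_of_all _ fun ω => (Real.norm_eq_abs _).trans_le (hψb _)))
    simpa only [relabel_shift_neg_neg_relabel_shift_neg] using h
  -- `D ψ` as a sum of indicators, integrated term by term
  have hsplit : ∀ ω, D ω * ψ ω = ∑ y ∈ (zdGraph 3).neighborFinset (0 : Site 3),
      {ω : BondConfig (Site 3) | s((0 : Site 3), y) ∈ ω}.indicator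
        (fun ω => θ y ω * ψ ω -
          θ (-y) (BondConfig.relabel (sym2Equiv (Site.shift (-y))) ω) * ψ ω) ω := by
    intro ω
    rw [hD, Finset.sum_mul]
    refine Finset.sum_congr rfl fun y _ => ?_
    simp only [Set.indicator_apply, Set.mem_setOf_eq]
    split_ifs
    · ring
    · exact zero_mul _
  have hIind : ∀ y ∈ (zdGraph 3).neighborFinset (0 : Site 3), Integrable
      ({ω : BondConfig (Site 3) | s((0 : Site 3), y) ∈ ω}.indicator
        (fun ω => θ y ω * ψ ω -
          θ (-y) (BondConfig.relabel (sym2Equiv (Site.shift (-y))) ω) * ψ ω))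
      ((bondPercolation (zdGraph 3) (criticalProbI 3)).restrict (percolatesAt (0 : Site 3))) := by
    intro y hy
    refine IntegrableOn.integrable_indicator ?_ (hO y)
    rw [IntegrableOn, Measure.restrict_restrict (hO y), Set.inter_comm]
    exact (hI2 y hy).sub' (hI3 y hy)
  have hind : ∀ y ∈ (zdGraph 3).neighborFinset (0 : Site 3),
      ∫ ω in percolatesAt (0 : Site 3), {ω : BondConfig (Site 3) | s((0 : Site 3), y) ∈ ω}.indicator
          (fun ω => θ y ω * ψ ω -
            θ (-y) (BondConfig.relabel (sym2Equiv (Site.shift (-y))) ω) * ψ ω) ω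
          ∂(bondPercolation (zdGraph 3) (criticalProbI 3)) =
        (∫ ω in percolatesAt (0 : Site 3) ∩ {ω | s((0 : Site 3), y) ∈ ω}, θ y ω * ψ ω
            ∂(bondPercolation (zdGraph 3) (criticalProbI 3))) -
          ∫ ω in percolatesAt (0 : Site 3) ∩ {ω | s((0 : Site 3), y) ∈ ω},
            θ (-y) (BondConfig.relabel (sym2Equiv (Site.shift (-y))) ω) * ψ ω
            ∂(bondPercolation (zdGraph 3) (criticalProbI 3)) := by
    intro y hy
    rw [setIntegral_indicator (hO y), integral_sub (hI2 y hy) (hI3 y hy)]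
  simp_rw [hsplit]
  rw [integral_finsetSum _ hIind, Finset.sum_congr rfl hind, Finset.sum_sub_distrib, sub_eq_zero]
  -- weak Kirchhoff, split: `∑_y ∫ θ_y ψ(· - y) = ∑_y ∫ θ_y ψ`
  have hK : ∑ y ∈ (zdGraph 3).neighborFinset (0 : Site 3),
      ∫ ω in percolatesAt (0 : Site 3) ∩ {ω | s((0 : Site 3), y) ∈ ω},
        θ y ω * ψ (BondConfig.relabel (sym2Equiv (Site.shift (-y))) ω)
        ∂(bondPercolation (zdGraph 3) (criticalProbI 3)) =
      ∑ y ∈ (zdGraph 3).neighborFinset (0 : Site 3),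
        ∫ ω in percolatesAt (0 : Site 3) ∩ {ω | s((0 : Site 3), y) ∈ ω}, θ y ω * ψ ω
          ∂(bondPercolation (zdGraph 3) (criticalProbI 3)) := by
    have hw := hweak ψ B hψm hψb
    simp only [mul_sub] at hw
    rw [← sub_eq_zero, ← Finset.sum_sub_distrib]
    refine Eq.trans (Finset.sum_congr rfl fun y hy => ?_) hw
    exact (integral_sub (hI1 y hy) (hI2 y hy)).symm
  rw [← hK, ← sum_neighborFinset_neg (fun y =>
    ∫ ω in percolatesAt (0 : Site 3) ∩ {ω | s((0 : Site 3), y) ∈ ω},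
      θ y ω * ψ (BondConfig.relabel (sym2Equiv (Site.shift (-y))) ω)
      ∂(bondPercolation (zdGraph 3) (criticalProbI 3)))]
  -- substitution `ω = ω' + y` in each term
  refine Finset.sum_congr rfl fun y hy => ?_
  have hy' : (zdGraph 3).Adj (0 : Site 3) y := (SimpleGraph.mem_neighborFinset _ _ _).1 hy
  rw [← setIntegral_comp_eq hy' (fun ω => θ (-y) ω *
    ψ (BondConfig.relabel (sym2Equiv (Site.shift (-(-y)))) ω))]
  simp only [relabel_shift_neg_neg_relabel_shift_neg]

/-! ### Clamp test function -/

/-- `t · clamp(t) ≥ 0` for the clamp `max (-1) (min 1 t)`. -/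
theorem mul_clamp_nonneg (t : ℝ) : 0 ≤ t * max (-1) (min 1 t) := by
  rcases le_total 0 t with ht | ht
  · exact mul_nonneg ht (le_max_of_le_right (le_min zero_le_one ht))
  · refine mul_nonneg_of_nonpos_of_nonpos ht ?_
    rw [min_eq_right (ht.trans zero_le_one)]
    exact max_le (by norm_num) ht

/-- `t · clamp(t) = 0` forces `t = 0`. -/
theorem eq_zero_of_mul_clamp_eq_zero {t : ℝ} (h : t * max (-1) (min 1 t) = 0) : t = 0 := by
  by_contra ht
  rcases lt_or_gt_of_ne ht with hlt | hgt
  · have h1 : max (-1) (min 1 t) < 0 := by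
      rw [min_eq_right (hlt.le.trans zero_le_one)]
      exact max_lt (by norm_num) hlt
    exact (mul_pos_of_neg_of_neg hlt h1).ne' h
  · exact (mul_pos hgt (lt_max_of_lt_right (lt_min one_pos hgt))).ne' h

/-! ### Kirchhoff's law at the origin, almost surely -/

/-- **Kirchhoff at the origin.**  Under weak Kirchhoff, the flux defect `D` (pinned by `hD`)
vanishes almost surely on `C`: test the recentred identity `∫_C D ψ = 0` with the clamp
`ψ = max(-1, min(1, D))` (bounded by `1`, measurable), so that `D ψ ≥ 0` integrates to `0`,
hence vanishes a.e. on `C`, hence `D` does. -/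
theorem ae_defect_eq_zero (θ : Site 3 → BondConfig (Site 3) → ℝ) (D : BondConfig (Site 3) → ℝ)
    (hD : ∀ ω, D ω = ∑ y ∈ (zdGraph 3).neighborFinset (0 : Site 3),
      if s((0 : Site 3), y) ∈ ω then
        θ y ω - θ (-y) (BondConfig.relabel (sym2Equiv (Site.shift (-y))) ω) else 0)
    (hθm : ∀ y, Measurable (θ y))
    (hθi : ∀ y ∈ (zdGraph 3).neighborFinset (0 : Site 3),
      IntegrableOn (θ y) (percolatesAt (0 : Site 3) ∩ {ω | s((0 : Site 3), y) ∈ ω})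
        (bondPercolation (zdGraph 3) (criticalProbI 3)))
    (hweak : ∀ (ψ : BondConfig (Site 3) → ℝ) (B : ℝ), Measurable ψ → (∀ ω, |ψ ω| ≤ B) →
      ∑ y ∈ (zdGraph 3).neighborFinset (0 : Site 3),
        ∫ ω in percolatesAt (0 : Site 3) ∩ {ω | s((0 : Site 3), y) ∈ ω},
          θ y ω * (ψ (BondConfig.relabel (sym2Equiv (Site.shift (-y))) ω) - ψ ω)
          ∂(bondPercolation (zdGraph 3) (criticalProbI 3)) = 0) :
    ∀ᵐ ω ∂(bondPercolation (zdGraph 3) (criticalProbI 3)),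
      ω ∈ percolatesAt (0 : Site 3) → D ω = 0 := by
  have hDm := measurable_defect hθm hD
  have hDi := integrableOn_defect hθi hD
  have hψm : Measurable fun ω => max (-1) (min 1 (D ω)) :=
    measurable_const.max (measurable_const.min hDm)
  have hψb : ∀ ω, |max (-1) (min 1 (D ω))| ≤ 1 := fun ω =>
    abs_le.2 ⟨le_max_left _ _, max_le (by norm_num) (min_le_left _ _)⟩
  have h0 := setIntegral_defect_mul hθi hD hweak hψm hψb
  have hint : Integrable (fun ω => D ω * max (-1) (min 1 (D ω)))
      ((bondPercolation (zdGraph 3) (criticalProbI 3)).restrict (percolatesAt (0 : Site 3))) :=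
    hDi.mul_bdd hψm.aestronglyMeasurable
      (ae_of_all _ fun ω => (Real.norm_eq_abs _).trans_le (hψb ω))
  have hae := (integral_eq_zero_iff_of_nonneg (fun ω => mul_clamp_nonneg (D ω)) hint).1 h0
  have h1 : ∀ᵐ ω ∂((bondPercolation (zdGraph 3) (criticalProbI 3)).restrict
      (percolatesAt (0 : Site 3))), D ω = 0 := by
    filter_upwards [hae] with ω hω
    exact eq_zero_of_mul_clamp_eq_zero hω
  exact (ae_restrict_iff' (measurableSet_percolatesAt_holds (0 : Site 3))).1 h1

end StubKirchhoffOfWeak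

open StubKirchhoffOfWeak in
/-- **Stub `stub_kirchhoffOfWeak`** of the crux `VerticalGamblersRuin` (line `registered`, rev 10;
exact registered signature): **Theorem B1(a–b) — a weakly Kirchhoff family of edge weights
satisfies Kirchhoff's node law pointwise.**  Let `θ_y : Ω → ℝ` be measurable, integrable on
`C ∩ O_y` for every lattice neighbour `y` of `0`, and weakly Kirchhoff:
`∑_{y ∼ 0} ∫_{C ∩ O_y} θ_y(ω) (ψ(ω - y) - ψ(ω)) dP_{p_c} = 0` for all bounded measurable `ψ`.  Then
`P_{p_c}`-almost surely, for every `x ∈ ℤ³` with `ω - x ∈ {0 ↔ ∞}` (i.e. `x` in the infinite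
cluster), `∑_{y ∈ N_{ω - x}(0)} (θ_y(ω - x) - θ_{-y}((ω - x) - y)) = 0`.  Proof: at `x = 0` this
is `StubKirchhoffOfWeak.ae_defect_eq_zero` (substitution `ω = ω' + y`, reindexing `y ↦ -y`,
clamp test function); for general `x` pull the null event back along the measure-preserving
shift `ω ↦ ω - x` and take the countable intersection over `x`. -/
theorem stub_kirchhoffOfWeak :
    ∀ sh : Site 3 → BondConfig (Site 3) → BondConfig (Site 3),
      (∀ (x : Site 3) (ω : BondConfig (Site 3)),
        sh x ω = BondConfig.relabel (sym2Equiv (Site.shift (-x))) ω) →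
    ∀ θ : Site 3 → BondConfig (Site 3) → ℝ, (∀ y, Measurable (θ y)) →
      (∀ y ∈ (zdGraph 3).neighborFinset (0 : Site 3),
        IntegrableOn (θ y) (percolatesAt (0 : Site 3) ∩ {ω | s((0 : Site 3), y) ∈ ω})
          (bondPercolation (zdGraph 3) (criticalProbI 3))) →
      (∀ (ψ : BondConfig (Site 3) → ℝ) (B : ℝ), Measurable ψ → (∀ ω, |ψ ω| ≤ B) →
        ∑ y ∈ (zdGraph 3).neighborFinset (0 : Site 3),
          ∫ ω in percolatesAt (0 : Site 3) ∩ {ω | s((0 : Site 3), y) ∈ ω},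
            θ y ω * (ψ (sh y ω) - ψ ω) ∂(bondPercolation (zdGraph 3) (criticalProbI 3)) = 0) →
      ∀ᵐ ω ∂(bondPercolation (zdGraph 3) (criticalProbI 3)), ∀ x : Site 3,
        sh x ω ∈ percolatesAt (0 : Site 3) →
          ∑ y ∈ ((zdGraph 3).neighborFinset (0 : Site 3)).filter
              (fun y => s((0 : Site 3), y) ∈ sh x ω),
            (θ y (sh x ω) - θ (-y) (sh y (sh x ω))) = 0 := by
  intro sh hsh θ hθm hθi hweak
  simp only [hsh] at hweak ⊢
  have h0 := ae_defect_eq_zero θ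
    (fun ω => ∑ y ∈ (zdGraph 3).neighborFinset (0 : Site 3),
      if s((0 : Site 3), y) ∈ ω then
        θ y ω - θ (-y) (BondConfig.relabel (sym2Equiv (Site.shift (-y))) ω) else 0)
    (fun _ => rfl) hθm hθi hweak
  refine ae_all_iff.2 fun x => ?_
  refine (((measurePreserving_shift (-x)).quasiMeasurePreserving).ae h0).mono fun ω h hω => ?_
  rw [Finset.sum_filter]
  exact h hω

end Summit.CriticalPhenomena.PercolationContinuityZ3.Theorems.VerticalGamblersRuin
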